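import Summits.ResolutionOfSingularities.ResolutionOfSingularities.Theorems.FrobeniusLadderFInjectiveMacaulayficationCMOverCodimFourResidue
import Summits.ResolutionOfSingularities.ResolutionOfSingularities.Theorems.FrobeniusLadderFInjectiveMacaulayficationRegularOffCodimFourResidue
import Summits.ResolutionOfSingularities.ResolutionOfSingularities.Theorems.FrobeniusLadderFInjectiveMacaulayficationUReduction
import Summits.ResolutionOfSingularities.ResolutionOfSingularities.Theorems.FrobeniusLadderFInjectiveMacaulayficationReductions
import HarnessLib

/-!
# Line U in INTEGRAL currency: the crux `FInjectiveMacaulayfication` from PF_FI and four named facts — no component glue needed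
# (crux stmt-ResolutionOfSingularities-15315, chain w45a; seat res-L1-w45a-stub-2; res-L1-w45a-plan-1 R15.31 / R15.36 / ACK 18:51:19Z
# «TREE SHAPE OF RECORD: crux ⟸ U1 ∧ PF_CM ∧ PF_FI by `UReduction.FInjectiveMacaulayfication_of_fi`»)

[OURS · L1 W4.5a] Support file (`--supports stmt-ResolutionOfSingularities-15315 --as helper`); NOT a statement of any manuscript; CONDITIONAL
results only (named facts BY NAME + the open core PF_FI as a hypothesis); no definitions; AI-written (AI review is weaker than expert review).

OBSERVATION. `UReduction.FInjectiveMacaulayfication_of_fi (hU) (hCM) (hFI)` wants U1 and PF_CM for REDUCED `X`, but both are proved so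
far only for INTEGRAL `X` (stub-3's `RegularOffCodimFourResidue.regularOffCodimFourResidue_of_isIntegral` p557070, this seat's
`CMOverCodimFourResidue.cmOverCodimFourResidue_integral` p558018); the reduced siblings need component separation. That glue is ALREADY
in the tree ONCE, at the level of the crux: `fInjectiveMacaulayfication_iff_integral` (the crux is equivalent to its integral
form). Hence the component glue need not be redone for U1 or PF_CM:

* `fInjectiveMacaulayfication_integral_of_fi` — the INTEGRAL FORM of the crux from U1-for-integral-`X`, PF_CM-for-integral-`X` (i.e. from
  `CossartPiltant2019General`, `Stacks081R`, `CossartPiltant2019Principalization`, `CesnaviciusMacaulayfication`, all BY NAME) and the open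
  core `UReduction.FIOverCMResidue` (used only at integral `X`);
* **`fInjectiveMacaulayfication_of_fiOverCMResidue (hG) (h081R) (hP) (hC) (hFI) : FrobeniusLadder.FInjectiveMacaulayfication`** — the crux
  itself, by `fInjectiveMacaulayfication_iff_integral`. So, IN THE TREE: **crux ⟸ PF_FI alone modulo four printed theorems**.

[cite: Temkin2008, Prop. 2.3.4] [cite: CossartPiltant2019, Thm. 1.1] [cite: Cesnavicius2021, Thm. 1.6]
-/

-- single-problem summit: the doubled namespace component is forced
set_option linter.dupNamespace false

noncomputable section

namespace Summit.ResolutionOfSingularities.ResolutionOfSingularities.Theorems.FInjectiveMacaulayfication.ULineIntegral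

open CategoryTheory AlgebraicGeometry
open Literature.AlgebraicGeometry.Resolution
open Summit.ResolutionOfSingularities.ResolutionOfSingularities.Theorems.FInjectiveMacaulayfication

/-- **The integral form of the crux from U1(integral) ∧ PF_CM(integral) ∧ PF_FI**: for `X` integral separated of finite type over `k` of
characteristic `p`, a proper birational INTEGRAL model with FULL stalks — compose Temkin/CP2019's `X₂ → X` (regular off a codim-≥-4 residue
`B`), Česnavičius' `X₃ → X₂` (Cohen–Macaulay domain stalks, still regular off `B`) and the PF_FI model `X₄ → X₃`; `X₄` is integral because
its stalks are domains and it is birational over the integral `X` (`isIntegral_of_isBirational_of_isDomain_stalk`).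
[OURS · conditional-result] -/
theorem fInjectiveMacaulayfication_integral_of_fi
    (hG : CossartPiltant2019General.{0}) (h081R : Stacks081R.{0}) (hP : CossartPiltant2019Principalization.{0})
    (hC : CesnaviciusMacaulayfication.{0}) (hFI : UReduction.FIOverCMResidue) :
    ∀ p : ℕ, p.Prime → ∀ (k : Type) [Field k] [CharP k p] (X : Scheme.{0})
      (f : X ⟶ Spec (.of k)), IsSeparated f → LocallyOfFiniteType f → QuasiCompact f →
      IsIntegral X →
      ∃ (X' : Scheme.{0}) (π : X' ⟶ X), IsProper π ∧ IsBirational π ∧ IsIntegral X' ∧ ∀ x : X',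
        IsDomain (X'.presheaf.stalk x) ∧ ∀ d : ℕ, ringKrullDim (X'.presheaf.stalk x) = d →
          ∀ s : Fin d → X'.presheaf.stalk x, (Ideal.span (Set.range s)).radical.IsMaximal →
            RingTheory.Sequence.IsWeaklyRegular (X'.presheaf.stalk x) (List.ofFn s) ∧
            ∀ y : X'.presheaf.stalk x, (∃ e : ℕ, y ^ p ^ e ∈ Ideal.span
              ((fun z : X'.presheaf.stalk x => z ^ p ^ e) ''
                (Ideal.span (Set.range s) : Set (X'.presheaf.stalk x)))) →
              y ∈ Ideal.span (Set.range s) := by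
  intro p hp k _ _ X f hsep hft hqc hint
  -- U1 for integral `X` (Temkin 2008 2.3.4 + Cossart–Piltant 2019, stub-3)
  obtain ⟨X₂, π₂, hprop₂, hbir₂, hred₂, B, hB, hB4, hreg₂⟩ :=
    RegularOffCodimFourResidue.regularOffCodimFourResidue_of_isIntegral hG h081R hP p hp k X f hsep hft hqc hint
  -- PF_CM for integral `X` (Česnavičius 2021, this seat)
  obtain ⟨X₃, π₃, hprop₃, hbir₃, hred₃, hcm₃, hreg₃⟩ :=
    CMOverCodimFourResidue.cmOverCodimFourResidue_integral hC k X f hsep hft hqc hint X₂ π₂ hprop₂ hbir₂ hred₂ B hB hB4 hreg₂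
  haveI := hprop₂
  haveI := hprop₃
  have hbir₃₂ : IsBirational (π₃ ≫ π₂) := ComponentGluing.IsBirational.comp hbir₃ hbir₂
  have hreg₃' : ∀ x₃ : X₃, (π₃ ≫ π₂).base x₃ ∉ B → IsRegularLocalRing (X₃.presheaf.stalk x₃) := by
    intro x₃ hx₃
    apply hreg₃
    simpa [Scheme.Hom.comp_base] using hx₃
  -- PF_FI (the open core), used at the integral `X`
  obtain ⟨X₄, π₄, hprop₄, hbir₄, hfull⟩ :=
    hFI p hp k X f hsep hft hqc inferInstance X₃ (π₃ ≫ π₂) inferInstance hbir₃₂ hred₃ hcm₃ B hB hB4 hreg₃'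
  haveI := hprop₄
  have hbir : IsBirational (π₄ ≫ π₃ ≫ π₂) := ComponentGluing.IsBirational.comp hbir₄ hbir₃₂
  exact ⟨X₄, π₄ ≫ π₃ ≫ π₂, inferInstance, hbir,
    isIntegral_of_isBirational_of_isDomain_stalk hbir fun x => (hfull x).1, hfull⟩

/-- **THE CRUX FROM PF_FI ALONE, modulo four printed theorems (line U in integral currency).** `FrobeniusLadder.FInjectiveMacaulayfication`
follows from `CossartPiltant2019General`, `Stacks081R`, `CossartPiltant2019Principalization` (U1, stub-3), `CesnaviciusMacaulayfication`
(PF_CM) — all BY NAME — and the open core `UReduction.FIOverCMResidue`, through the crux's integral form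
(`fInjectiveMacaulayfication_iff_integral`): no reduced sibling of U1 / PF_CM (component separation) is needed.
[OURS · conditional-result] [cite: Temkin2008, Prop. 2.3.4] [cite: CossartPiltant2019, Thm. 1.1] [cite: Cesnavicius2021, Thm. 1.6] -/
theorem fInjectiveMacaulayfication_of_fiOverCMResidue
    (hG : CossartPiltant2019General.{0}) (h081R : Stacks081R.{0}) (hP : CossartPiltant2019Principalization.{0})
    (hC : CesnaviciusMacaulayfication.{0}) (hFI : UReduction.FIOverCMResidue) :
    Summit.ResolutionOfSingularities.ResolutionOfSingularities.Theses.FrobeniusLadder.FInjectiveMacaulayfication :=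
  fInjectiveMacaulayfication_iff_integral.mpr (fInjectiveMacaulayfication_integral_of_fi hG h081R hP hC hFI)

/-! ## The open core may be posed for INTEGRAL schemes only -/

/-- **PF_FI restricted to integral `X` and integral `X₃` suffices for the crux** (same composition; `X₃` is integral because it is
birational over the integral `X` with domain stalks). So the open core of line U is a statement about INTEGRAL Cohen–Macaulay models of
INTEGRAL varieties, regular off a codimension-≥-4 residue. [OURS · conditional-result]
[cite: Temkin2008, Prop. 2.3.4] [cite: CossartPiltant2019, Thm. 1.1] [cite: Cesnavicius2021, Thm. 1.6] -/
theorem fInjectiveMacaulayfication_of_fiOverCMResidue_integral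
    (hG : CossartPiltant2019General.{0}) (h081R : Stacks081R.{0}) (hP : CossartPiltant2019Principalization.{0})
    (hC : CesnaviciusMacaulayfication.{0})
    (hFI : ∀ p : ℕ, p.Prime → ∀ (k : Type) [Field k] [CharP k p] (X : Scheme.{0}) (f : X ⟶ Spec (.of k)),
      IsSeparated f → LocallyOfFiniteType f → QuasiCompact f → IsIntegral X →
      ∀ (X₃ : Scheme.{0}) (π : X₃ ⟶ X), IsProper π → IsBirational π → IsIntegral X₃ → UReduction.CMStalks X₃ →
      ∀ B : Set X, IsClosed B → (∀ b ∈ B, (4 : WithBot ℕ∞) ≤ ringKrullDim (X.presheaf.stalk b)) →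
        (∀ x₃ : X₃, π.base x₃ ∉ B → IsRegularLocalRing (X₃.presheaf.stalk x₃)) →
        ∃ (X₄ : Scheme.{0}) (π₄ : X₄ ⟶ X₃), IsProper π₄ ∧ IsBirational π₄ ∧ UReduction.FullStalks p X₄) :
    Summit.ResolutionOfSingularities.ResolutionOfSingularities.Theses.FrobeniusLadder.FInjectiveMacaulayfication := by
  refine fInjectiveMacaulayfication_iff_integral.mpr fun p hp k _ _ X f hsep hft hqc hint => ?_
  obtain ⟨X₂, π₂, hprop₂, hbir₂, hred₂, B, hB, hB4, hreg₂⟩ :=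
    RegularOffCodimFourResidue.regularOffCodimFourResidue_of_isIntegral hG h081R hP p hp k X f hsep hft hqc hint
  obtain ⟨X₃, π₃, hprop₃, hbir₃, hred₃, hcm₃, hreg₃⟩ :=
    CMOverCodimFourResidue.cmOverCodimFourResidue_integral hC k X f hsep hft hqc hint X₂ π₂ hprop₂ hbir₂ hred₂ B hB hB4 hreg₂
  haveI := hprop₂
  haveI := hprop₃
  have hbir₃₂ : IsBirational (π₃ ≫ π₂) := ComponentGluing.IsBirational.comp hbir₃ hbir₂
  have hint₃ : IsIntegral X₃ := isIntegral_of_isBirational_of_isDomain_stalk hbir₃₂ fun x => (hcm₃ x).1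
  have hreg₃' : ∀ x₃ : X₃, (π₃ ≫ π₂).base x₃ ∉ B → IsRegularLocalRing (X₃.presheaf.stalk x₃) := by
    intro x₃ hx₃
    apply hreg₃
    simpa [Scheme.Hom.comp_base] using hx₃
  obtain ⟨X₄, π₄, hprop₄, hbir₄, hfull⟩ :=
    hFI p hp k X f hsep hft hqc hint X₃ (π₃ ≫ π₂) inferInstance hbir₃₂ hint₃ hcm₃ B hB hB4 hreg₃'
  haveI := hprop₄
  have hbir : IsBirational (π₄ ≫ π₃ ≫ π₂) := ComponentGluing.IsBirational.comp hbir₄ hbir₃₂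
  exact ⟨X₄, π₄ ≫ π₃ ≫ π₂, inferInstance, hbir,
    isIntegral_of_isBirational_of_isDomain_stalk hbir fun x => (hfull x).1, hfull⟩

/-- Sanity: the integral form of PF_FI used above is a WEAKENING of `UReduction.FIOverCMResidue` (integral schemes are reduced). [plumbing] -/
theorem fiOverCMResidue_integral_of_fiOverCMResidue (hFI : UReduction.FIOverCMResidue) :
    ∀ p : ℕ, p.Prime → ∀ (k : Type) [Field k] [CharP k p] (X : Scheme.{0}) (f : X ⟶ Spec (.of k)),
      IsSeparated f → LocallyOfFiniteType f → QuasiCompact f → IsIntegral X →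
      ∀ (X₃ : Scheme.{0}) (π : X₃ ⟶ X), IsProper π → IsBirational π → IsIntegral X₃ → UReduction.CMStalks X₃ →
      ∀ B : Set X, IsClosed B → (∀ b ∈ B, (4 : WithBot ℕ∞) ≤ ringKrullDim (X.presheaf.stalk b)) →
        (∀ x₃ : X₃, π.base x₃ ∉ B → IsRegularLocalRing (X₃.presheaf.stalk x₃)) →
        ∃ (X₄ : Scheme.{0}) (π₄ : X₄ ⟶ X₃), IsProper π₄ ∧ IsBirational π₄ ∧ UReduction.FullStalks p X₄ := by
  intro p hp k _ _ X f hsep hft hqc _ X₃ π hprop hbir _ hcm B hB hB4 hreg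
  exact hFI p hp k X f hsep hft hqc inferInstance X₃ π hprop hbir inferInstance hcm B hB hB4 hreg

end Summit.ResolutionOfSingularities.ResolutionOfSingularities.Theorems.FInjectiveMacaulayfication.ULineIntegral

end
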